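import Summits.SmoothPoincare4.SmoothPoincare4.Theorems.RootDecompAEDoublesBeyondShadowTwoLedgerTwinsA

/-!
# Grade-four ownership ledger `LocalTableLE4 → GradeFourDichotomy` for KMN encoding graphs, part 2/15: verbatim twins of the pieces, the encoding graphs, the certificate format and the statements

Verbatim twins of the skeleton: `Block.toFG5`, `blockPorts`, `Piece` (l.421–479), the encoding graph `ShadowGraph`
with its uniform presentation `P(G)` (l.483–563), `Roe.substHom` / `Roe.Step` / `Roe.Valid` / `Roe.HasCertificate`
(l.567–605) and the statements `LocalTableLE4` (l.627–633), `GradeFourDichotomy` (l.635–639), `LedgerFour`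
(l.641–644), re-certified by `Iff.rfl`.

THE FAMILY (14 modules `Theorems/RootDecompAEDoublesBeyondShadowTwoLedger*.lean` + the closing module
`Theorems/RootDecompAEDoublesBeyondShadowTwoStubLedgerFour.lean`, one namespace
`Summit.SmoothPoincare4.SmoothPoincare4.Theorems.RootDecompAEDoublesBeyondShadowTwoStubLedgerFour`, linearly chained
imports, split by topic to respect the 400-line bound on proof files).
-/

open Function
open Literature.Topology.FourManifolds

set_option linter.dupNamespace false

noncomputable section

namespace Summit.SmoothPoincare4.SmoothPoincare4.Theorems.RootDecompAEDoublesBeyondShadowTwoStubLedgerFour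

/-- A traced word as an element of `F₅ = ⟨x₀, …, x₄⟩` (letters are `< 5` for every shape with `V ≤ 4`). -/
def Block.toFG5 (w : List (ℕ × Bool)) : FreeGroup (Fin 5) :=
  FreeGroup.mk (w.map fun g => ((⟨g.1 % 5, Nat.mod_lt _ (by norm_num)⟩ : Fin 5), g.2))

/-- The port words of the block of shape `s` with decoration code `code`, in `F₅`. -/
def blockPorts (s : BlockShape) (code : ℕ) : List (FreeGroup (Fin 5)) :=
  (Block.ports s.shape (Block.decode (2 * s.V) (code % s.numDeco))).map Block.toFG5

/-- Spine letters `a, b` of the grade ≤ 1 pieces (five letters for every piece; a piece of rank `r` uses the first `r`). -/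
def la : FreeGroup (Fin 5) := FreeGroup.of 0
/-- Second spine letter. -/
def lb : FreeGroup (Fin 5) := FreeGroup.of 1

/-- The pieces of a simple polyhedron of connected complexity ≤ 4: KMN's pieces without true vertices, and the decorated
blocks with 1, 2, 3 or 4 true vertices. -/
inductive Piece : Type
  | disc
  | pants
  | moebius
  | y111
  | y12
  | y3
  | block (s : BlockShape) (code : ℕ)
  deriving DecidableEq

namespace Piece

/-- Rank of the free fundamental group of the piece's spine (point, circle, figure-eight, 4-regular graph on `V` vertices). -/
def rank : Piece → ℕ
  | disc => 0
  | pants => 2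
  | moebius => 1
  | y111 => 1
  | y12 => 1
  | y3 => 1
  | block s _ => s.V + 1

/-- Port words of every piece (grade ≤ 1 pieces as in the grade-one line; blocks by the block calculus). -/
def ports : Piece → List (FreeGroup (Fin 5))
  | disc => [1]
  | pants => [la, lb, la * lb]
  | moebius => [la * la]
  | y111 => [la, la, la]
  | y12 => [la, la * la]
  | y3 => [la * la * la]
  | block s code => blockPorts s code

/-- Number of boundary circles (ports) of a piece. -/
def numPorts (p : Piece) : ℕ := p.ports.length

/-- The `j`-th port word of a piece (junk value `1` out of range). -/
def portWord (p : Piece) (j : ℕ) : FreeGroup (Fin 5) := p.ports.getD j 1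

/-- Number of true vertices inside the piece. -/
def numTrueVertices : Piece → ℕ
  | block s _ => s.V
  | _ => 0

end Piece

/-! ### Twins of skeleton §3: encoding graphs and their graph-of-spaces presentations (five letters per piece) -/

/-- A KMN ENCODING GRAPH at connected complexity ≤ 4: `k` pieces, `m` glued port pairs with orientation signs, a chosen
spanning tree (same data as the grade-one line's `ShadowGraph`, over the larger piece type). -/
structure ShadowGraph where
  /-- number of pieces -/
  k : ℕ
  /-- number of glued port pairs -/
  m : ℕ
  /-- the piece at each vertex of the encoding graph -/
  piece : Fin k → Piece
  /-- first port of the `e`-th gluing: (piece index, port index) -/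
  src : Fin m → Fin k × ℕ
  /-- second port of the `e`-th gluing -/
  tgt : Fin m → Fin k × ℕ
  /-- gluing orientation of the `e`-th pair of boundary circles -/
  sgn : Fin m → Bool
  /-- the edges of the chosen spanning tree (their stable letters are killed) -/
  tree : Fin m → Bool

namespace ShadowGraph

variable (G : ShadowGraph)

/-- All `2m` port references used by the gluings. -/
def endpoints : Fin G.m ⊕ Fin G.m → Fin G.k × ℕ := Sum.elim G.src G.tgt

/-- Every referenced port exists. -/
def PortsValid : Prop :=
  ∀ e : Fin G.m, (G.src e).2 < (G.piece (G.src e).1).numPorts ∧ (G.tgt e).2 < (G.piece (G.tgt e).1).numPorts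

/-- No boundary circle is glued twice. -/
def PortsInjective : Prop := Function.Injective G.endpoints

/-- The simple graph on pieces spanned by the tree edges. -/
def treeAdj : SimpleGraph (Fin G.k) :=
  SimpleGraph.fromRel fun u v => ∃ e : Fin G.m, G.tree e = true ∧ (G.src e).1 = u ∧ (G.tgt e).1 = v

/-- The tree edges form a spanning tree of the encoding graph. -/
def IsSpanningTree : Prop :=
  (∀ e, G.tree e = true → (G.src e).1 ≠ (G.tgt e).1) ∧ G.treeAdj.Connected ∧
    (Finset.univ.filter fun e => G.tree e = true).card + 1 = G.k

/-- ADMISSIBLE encoding graphs: valid ports, no port glued twice, a genuine spanning tree.  (Connected complexity ≤ 4 is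
automatic: every block is a whole component of the singular set.) -/
def Admissible : Prop := G.PortsValid ∧ G.PortsInjective ∧ G.IsSpanningTree

/-- Number of true vertices of `X_G` (sub-grading; `≤ 4` per singular component by construction). -/
def numVertices : ℕ := ∑ v, (G.piece v).numTrueVertices

/-- GENERATORS: four spine letters per piece and one stable letter per glued pair. -/
abbrev Gen : Type := (Fin G.k × Fin 5) ⊕ Fin G.m

/-- RELATOR INDICES: one gluing relator per glued pair, one killing relator per tree edge, one killing relator per unused
spine letter `(v, i)` with `rank(piece v) ≤ i`. -/
abbrev Rel : Type := Fin G.m ⊕ {e : Fin G.m // G.tree e = true} ⊕ {p : Fin G.k × Fin 5 // (G.piece p.1).rank ≤ (p.2 : ℕ)}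

/-- The spine letters of piece `v` inside the big free group. -/
def embed (v : Fin G.k) : FreeGroup (Fin 5) →* FreeGroup G.Gen :=
  FreeGroup.map fun i => Sum.inl (v, i)

/-- The word of port `(v, j)` in the big free group. -/
def portWordAt (p : Fin G.k × ℕ) : FreeGroup G.Gen := G.embed p.1 ((G.piece p.1).portWord p.2)

/-- The stable letter of the `e`-th glued pair. -/
def stable (e : Fin G.m) : FreeGroup G.Gen := FreeGroup.of (Sum.inr e)

/-- The GLUING RELATOR of the `e`-th pair: `w_src · t_e · w_tgt^{±1} · t_e⁻¹`. -/
def gluingRelator (e : Fin G.m) : FreeGroup G.Gen :=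
  G.portWordAt (G.src e) * G.stable e * (if G.sgn e then G.portWordAt (G.tgt e) else (G.portWordAt (G.tgt e))⁻¹) *
    (G.stable e)⁻¹

/-- All relators of the uniform encoding. -/
def relator : G.Rel → FreeGroup G.Gen
  | Sum.inl e => G.gluingRelator e
  | Sum.inr (Sum.inl e) => G.stable e.1
  | Sum.inr (Sum.inr p) => FreeGroup.of (Sum.inl p.1)

/-- THE PRESENTATION `P(G)`, transported to `Fin n` along bijections of the index types (balanced iff `Σ_v rank = k − 1`). -/
def presentation {n : ℕ} (eg : G.Gen ≃ Fin n) (er : G.Rel ≃ Fin n) : BalancedPresentation n :=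
  fun j => FreeGroup.map eg (G.relator (er.symm j))

end ShadowGraph

/-! ### Twins of skeleton §4a: recursive one-occurrence elimination certificates; the statements (skeleton §4c) -/

namespace Roe

variable {n : ℕ}

/-- The substitution `x ↦ W⁻¹`, all other letters fixed. -/
def substHom (x : Fin n) (W : FreeGroup (Fin n)) : FreeGroup (Fin n) →* FreeGroup (Fin n) :=
  FreeGroup.lift fun y => if y = x then W⁻¹ else FreeGroup.of y

/-- One elimination step: relator index, eliminated letter, the complementary word, and a sign. -/
structure Step (n : ℕ) where
  /-- the relator used at this step -/
  rel : Fin n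
  /-- the letter eliminated at this step -/
  letter : Fin n
  /-- the word `W` with `relator ~ (letter · W)^{±1}` -/
  word : FreeGroup (Fin n)
  /-- `true`: the relator is conjugate to `letter · W`; `false`: to its inverse -/
  sgn : Bool

/-- VALIDITY of a step list from a state (accumulated substitution `Φ`, eliminated letters `E`, used relators `U`):
the next relator, AFTER the substitutions so far, is conjugate to `(x · W)^{±1}` with `x` fresh and `W` a word in the
letters that are neither eliminated nor `x`; then `x ↦ W⁻¹` is composed into `Φ`.  At the end every letter is eliminated
and every relator used. -/
def Valid (P : BalancedPresentation n) :
    List (Step n) → (FreeGroup (Fin n) →* FreeGroup (Fin n)) → Finset (Fin n) → Finset (Fin n) → Prop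
  | [], _, E, U => E = Finset.univ ∧ U = Finset.univ
  | s :: rest, Φ, E, U =>
      s.letter ∉ E ∧ s.rel ∉ U ∧
      s.word ∈ Subgroup.closure (FreeGroup.of '' {y : Fin n | y ∉ E ∧ y ≠ s.letter}) ∧
      IsConj (Φ (P s.rel))
        (if s.sgn then FreeGroup.of s.letter * s.word else (FreeGroup.of s.letter * s.word)⁻¹) ∧
      Valid P rest ((substHom s.letter s.word).comp Φ) (insert s.letter E) (insert s.rel U)

/-- `P` admits a recursive one-occurrence elimination certificate.  (The grade-one ERASURE certificates of gen 12 —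
`IsConj (erase_{rk < rk i} (P (σ i))) (xᵢ^{±1})` — are the special case `W = 1` at every step.) -/
def HasCertificate (P : BalancedPresentation n) : Prop :=
  ∃ steps : List (Step n), Valid P steps (MonoidHom.id _) ∅ ∅

end Roe

/-- STATEMENT OF STUB 2b (FINITE; `V ≤ 3` machine-certified in the gen14 instrument file `G14Certificates.lean` by `decide` /
`native_decide` over all `36 + 2·1 296 + 4·46 656` decorations, `V = 4` EXHAUSTIVELY checked by `enum/fast4.py` over all
`10·6⁸ = 16 796 160` decorated blocks — 1 761 954 owned 5-tuples, 540 360 unimodular, all ROE): THE LOCAL TABLE (★≤4) —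
for every block with at most four true vertices, every unimodular owned tuple of port words admits a recursive
one-occurrence elimination. -/
def LocalTableLE4 : Prop :=
  ∀ (s : BlockShape) (n : ℕ), n < s.numDeco → Block.localCheck s.shape (Block.decode (2 * s.V) n) = true

/-- The grade-four DICHOTOMY in certificate form: the presentation of an admissible grade-four encoding graph that presents
the trivial group admits an elimination certificate. -/
def GradeFourDichotomy : Prop :=
  ∀ (G : ShadowGraph) (n : ℕ) (eg : G.Gen ≃ Fin n) (er : G.Rel ≃ Fin n),
    G.Admissible → (G.presentation eg er).PresentsTrivialGroup → Roe.HasCertificate (G.presentation eg er)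

/-- STATEMENT OF STUB 2a (LOAD-BEARING, conceptual — the OWNERSHIP LEDGER, gen13 NODE §1 / §4 verbatim one grade up): the local
table implies the dichotomy (tree WLOG, cut excesses ∈ {0,1} else `H₁ ≠ 0`, canonical ownership, `|det| = ∏ local minors`,
level induction; the only grade-dependent input is (★≤4)). -/
def LedgerFour : Prop := LocalTableLE4 → GradeFourDichotomy

/-- The twinned statement is, by `rfl`, the implication between the twinned local table and the twinned dichotomy. -/
example : LedgerFour ↔ (LocalTableLE4 → GradeFourDichotomy) := Iff.rfl

/-- The twinned dichotomy unfolds, by `rfl`, to its defining formula. -/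
example : GradeFourDichotomy ↔
    ∀ (G : ShadowGraph) (n : ℕ) (eg : G.Gen ≃ Fin n) (er : G.Rel ≃ Fin n),
      G.Admissible → (G.presentation eg er).PresentsTrivialGroup → Roe.HasCertificate (G.presentation eg er) := Iff.rfl

/-- The twinned local table unfolds, by `rfl`, to its defining formula. -/
example : LocalTableLE4 ↔
    ∀ (s : BlockShape) (n : ℕ), n < s.numDeco → Block.localCheck s.shape (Block.decode (2 * s.V) n) = true := Iff.rfl

end Summit.SmoothPoincare4.SmoothPoincare4.Theorems.RootDecompAEDoublesBeyondShadowTwoStubLedgerFour
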